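import Mathlib
import HarnessLib
import Literature.NumberTheory.DiophantineGeometry.BelyiPairNoDeep

/-!
# Cluster points are central; no two comparable central points

(Layer 4 of the bad-prime floor for the Belyi degree.)

* `IsBelyiPair.card_intRoots_ne`, `IsBelyiPair.rootMultiplicity_ne` — the edge points just above the
  Gauss point and just inside a residue class are not fully neutral (rescale to a radius strictly
  between and use `not_fullyNeutral`);
* `IsBelyiPair.not_gaussVal_lt_of_isClusterPair`, `IsBelyiPair.central_of_isClusterPair` —
  **cluster points are central**: a tame Belyi pair with two integral special points of different
  residues has `gaussVal p = gaussVal q = gaussVal (p - q)` (in the `0`-region the reduction of `p/q`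
  is non-constant with zeros and poles exactly at the classes with special points, unramified
  elsewhere, and the two-point Riemann–Hurwitz count allows only one such class; the other regions
  follow by the symmetries `q/p`, `1 - p/q`);
* `IsBelyiPair.not_central_below` — **no two comparable central points** with no special points at
  intermediate distances (the three Gauss values are monomials in the radius; equal at both ends
  forces equal exponents, i.e. a fully neutral point in between).

Folklore (cf. Zannier, Israel J. Math. 124 (2001)); everything proved, no named facts.
-/

noncomputable section

namespace Literature.NumberTheory.DiophantineGeometry

open Polynomial IsLocalRing Literature.RingTheory.Valuation
open scoped Classical

section Cluster

variable {K : Type*} [Field K] [IsAlgClosed K] [CharZero K] (A : ValuationSubring K)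
variable {d : ℕ} {p q : K[X]}

omit [IsAlgClosed K] [CharZero K] in
/-- `IsClusterPair` only depends on the set of special points: transfer to the swapped pair.
[folklore] -/
theorem IsClusterPair.swap (hcl : IsClusterPair A p q) : IsClusterPair A q p := by
  have e : (q * p * (q - p)).roots = (p * q * (p - q)).roots := by
    have : q * p * (q - p) = -(p * q * (p - q)) := by ring
    rw [this, roots_neg]
  unfold IsClusterPair; rw [e]; exact hcl

omit [IsAlgClosed K] [CharZero K] in
/-- Transfer of `IsClusterPair` to the pair `(q - p, q)`. [folklore] -/
theorem IsClusterPair.oneSub (hcl : IsClusterPair A p q) : IsClusterPair A (q - p) q := by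
  have e : ((q - p) * q * (q - p - q)).roots = (p * q * (p - q)).roots := by
    congr 1; ring
  unfold IsClusterPair; rw [e]; exact hcl

omit [CharZero K] in
/-- In the `0`-region (`gaussVal p < gaussVal q`) the reduction of `p - q` is that of `q`.
[folklore] -/
theorem redPoly_sub_eq_of_gaussVal_lt (hlt : gaussVal A p < gaussVal A q) :
    redPoly A (p - q) = redPoly A q := by
  have e : p - q = C (-1) * q + p := by rw [map_neg, C_1]; ring
  have hlt' : gaussVal A p < gaussVal A (C (-1) * q) := by
    rw [gaussVal_C_mul, Valuation.map_neg, map_one, one_mul]; exact hlt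
  rw [e, redPoly_add_of_gaussVal_lt (IsAlgClosed.splits _) (IsAlgClosed.splits _) hlt',
    redPoly_C_mul A (by norm_num)]

/-- **Edge points above the unit disc are not fully neutral**: if `#intRoots p = #intRoots q
= #intRoots (p - q)` for a tame Belyi pair with an integral special point, contradiction.
(If all special points are integral the three degrees would coincide; otherwise rescale to a radius
strictly between `1` and the nearest outer special point.) [folklore] -/
theorem IsBelyiPair.card_intRoots_ne (h : IsBelyiPair d p q)
    (htame : ∀ n : ℕ, 0 < n → n ≤ d → (n : ResidueField A) ≠ 0) {s₀ : K}
    (hs₀F : s₀ ∈ (p * q * (p - q)).roots) (hs₀A : s₀ ∈ A)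
    (hpq : Multiset.card (intRoots A p) = Multiset.card (intRoots A q))
    (hrq : Multiset.card (intRoots A (p - q)) = Multiset.card (intRoots A q)) : False := by
  by_cases hall : ∀ s ∈ (p * q * (p - q)).roots, s ∈ A
  · -- all special points integral: degrees coincide
    have hint : ∀ {f : K[X]}, (∀ s ∈ f.roots, s ∈ A) → Multiset.card (intRoots A f) = f.natDegree := by
      intro f hf
      rw [card_intRoots, Multiset.filter_eq_self.mpr hf]
      exact ((IsAlgClosed.splits f).natDegree_eq_card_roots).symm
    have hp : ∀ s ∈ p.roots, s ∈ A := fun s hs => hall s (by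
      rw [h.roots_prod]; exact Multiset.mem_add.mpr (Or.inl (Multiset.mem_add.mpr (Or.inl hs))))
    have hq : ∀ s ∈ q.roots, s ∈ A := fun s hs => hall s (by
      rw [h.roots_prod]; exact Multiset.mem_add.mpr (Or.inl (Multiset.mem_add.mpr (Or.inr hs))))
    have hr : ∀ s ∈ (p - q).roots, s ∈ A := fun s hs => hall s (by
      rw [h.roots_prod]; exact Multiset.mem_add.mpr (Or.inr hs))
    rw [hint hp, hint hq] at hpq
    rw [hint hr, hint hq] at hrq
    have hmax := h.natDegree_eq
    rcases h.drop with h' | h' | h' <;> omega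
  · push Not at hall
    obtain ⟨sout, hsoutF, hsoutA⟩ := hall
    have hsout1 : 1 < A.valuation (sout - s₀) := by
      rw [← not_le, ← mem_iff_valuation_sub_le_one A hs₀A]; exact hsoutA
    set Sout := ((p * q * (p - q)).roots.toFinset.filter fun s => 1 < A.valuation (s - s₀)) with hSout
    obtain ⟨s₁, hs₁, hs₁min⟩ := Finset.exists_min_image Sout (fun s => A.valuation (s - s₀))
      ⟨sout, Finset.mem_filter.mpr ⟨Multiset.mem_toFinset.mpr hsoutF, hsout1⟩⟩
    rw [Finset.mem_filter, Multiset.mem_toFinset] at hs₁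
    obtain ⟨hs₁F, hs₁gt⟩ := hs₁
    have hmin : ∀ s ∈ (p * q * (p - q)).roots, 1 < A.valuation (s - s₀) →
        A.valuation (s₁ - s₀) ≤ A.valuation (s - s₀) := fun s hs h1 =>
      hs₁min s (Finset.mem_filter.mpr ⟨Multiset.mem_toFinset.mpr hs, h1⟩)
    obtain ⟨γ, h1γ, hγs₁⟩ := exists_between_of_lt A one_ne_zero hs₁gt
    obtain ⟨e, he⟩ := A.valuation_surjective γ
    rw [← he] at h1γ hγs₁
    have he0 : e ≠ 0 := by
      intro h0; rw [h0, map_zero] at h1γ; exact (not_lt.mpr zero_le) h1γ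
    -- every root of `p q (p - q)` in `D(s₀, v e)` is at distance `≤ 1 < v e`
    have hinside : ∀ {f : K[X]}, (∀ s ∈ f.roots, s ∈ (p * q * (p - q)).roots) →
        (∀ α ∈ f.roots, A.valuation (α - s₀) ≤ A.valuation e → A.valuation (α - s₀) < A.valuation e) ∧
        rootsIn A f s₀ (A.valuation e) = Multiset.card (intRoots A f) := by
      intro f hf
      have hle1 : ∀ α ∈ f.roots, A.valuation (α - s₀) ≤ A.valuation e → A.valuation (α - s₀) ≤ 1 := by
        intro α hα hle
        by_contra hgt
        rw [not_le] at hgt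
        exact absurd ((hmin α (hf α hα) hgt).trans hle) (not_le.mpr hγs₁)
      refine ⟨fun α hα hle => lt_of_le_of_lt (hle1 α hα hle) h1γ, ?_⟩
      rw [card_intRoots_eq_rootsIn_one A f hs₀A, rootsIn, rootsIn]
      congr 1
      exact Multiset.filter_congr fun α hα => ⟨fun hle => hle1 α hα hle, fun hle => hle.trans h1γ.le⟩
    have hpF : ∀ s ∈ p.roots, s ∈ (p * q * (p - q)).roots := fun s hs => by
      rw [h.roots_prod]; exact Multiset.mem_add.mpr (Or.inl (Multiset.mem_add.mpr (Or.inl hs)))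
    have hqF : ∀ s ∈ q.roots, s ∈ (p * q * (p - q)).roots := fun s hs => by
      rw [h.roots_prod]; exact Multiset.mem_add.mpr (Or.inl (Multiset.mem_add.mpr (Or.inr hs)))
    have hrF : ∀ s ∈ (p - q).roots, s ∈ (p * q * (p - q)).roots := fun s hs => by
      rw [h.roots_prod]; exact Multiset.mem_add.mpr (Or.inr hs)
    obtain ⟨hp1, hp2⟩ := hinside hpF
    obtain ⟨hq1, hq2⟩ := hinside hqF
    obtain ⟨hr1, hr2⟩ := hinside hrF
    -- the rescaled pair at `(s₀, e)` is fully neutral: contradiction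
    have h' := h.comp s₀ he0
    refine h'.not_fullyNeutral A htame (zero_mem_roots_prod_comp hs₀F he0) A.zero_mem ⟨?_, ?_⟩
    · rw [redPoly_comp_eq_X_pow A p s₀ he0 hp1, redPoly_comp_eq_X_pow A q s₀ he0 hq1, hp2, hq2, hpq]
    · rw [← sub_comp, redPoly_comp_eq_X_pow A (p - q) s₀ he0 hr1,
        redPoly_comp_eq_X_pow A q s₀ he0 hq1, hr2, hq2, hrq]

/-- **Edge points below the unit disc are not fully neutral**: a residue class of a tame Belyi
pair at which the three reductions have the SAME positive order does not exist.  (Rescale into the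
class, to a radius strictly between its cluster radius and `1`.) [folklore] -/
theorem IsBelyiPair.rootMultiplicity_ne (h : IsBelyiPair d p q)
    (htame : ∀ n : ℕ, 0 < n → n ≤ d → (n : ResidueField A) ≠ 0) {x : ResidueField A}
    (hx : 0 < (redPoly A q).rootMultiplicity x)
    (hpq : (redPoly A p).rootMultiplicity x = (redPoly A q).rootMultiplicity x)
    (hrq : (redPoly A (p - q)).rootMultiplicity x = (redPoly A q).rootMultiplicity x) : False := by
  have hp0 := h.left_ne_zero
  have hq0 := h.right_ne_zero
  -- a pole and a zero in the class `x`
  obtain ⟨β₀, hβ₀, hβ₀x⟩ : ∃ β ∈ intRoots A q, residue A β = x := by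
    have : 0 < (redRoots A q).count x := by rwa [← rootMultiplicity_redPoly]
    obtain ⟨β, hβ, hβx⟩ := Multiset.mem_map.mp (Multiset.count_pos.mp this)
    exact ⟨β, hβ, hβx⟩
  obtain ⟨α₀, hα₀, hα₀x⟩ : ∃ α ∈ intRoots A p, residue A α = x := by
    have : 0 < (redRoots A p).count x := by rw [← rootMultiplicity_redPoly, hpq]; exact hx
    obtain ⟨α, hα, hαx⟩ := Multiset.mem_map.mp (Multiset.count_pos.mp this)
    exact ⟨α, hα, hαx⟩
  set s₀ : K := (β₀ : K) with hs₀
  have hs₀A : s₀ ∈ A := β₀.2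
  have hs₀q : s₀ ∈ q.roots := (mem_intRoots A).mp hβ₀
  have hs₀F : s₀ ∈ (p * q * (p - q)).roots := by
    rw [h.roots_prod]; exact Multiset.mem_add.mpr (Or.inl (Multiset.mem_add.mpr (Or.inr hs₀q)))
  have hres₀ : residue A ⟨s₀, hs₀A⟩ = x := by rw [← hβ₀x]
  have hα₀p : (α₀ : K) ∈ p.roots := (mem_intRoots A).mp hα₀
  have hα₀s₀ : (α₀ : K) ≠ s₀ := by
    intro heq
    have hps : p.IsRoot s₀ := by rw [← heq]; exact (mem_roots hp0).mp hα₀p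
    have := rootMultiplicity_eq_zero_of_isCoprime_of_isRoot h.isCoprime hps
    exact ((rootMultiplicity_pos hq0).mpr ((mem_roots hq0).mp hs₀q)).ne' this
  have hα₀F : (α₀ : K) ∈ (p * q * (p - q)).roots := by
    rw [h.roots_prod]; exact Multiset.mem_add.mpr (Or.inl (Multiset.mem_add.mpr (Or.inl hα₀p)))
  have hα₀lt : A.valuation ((α₀ : K) - s₀) < 1 :=
    valuation_sub_lt_one_of_residue_eq A α₀.2 hs₀A (by simpa using hα₀x.trans hres₀.symm)
  -- the cluster radius of the class
  set Sv := ((p * q * (p - q)).roots.toFinset.filter fun s => A.valuation (s - s₀) < 1 ∧ s ≠ s₀) with hSv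
  obtain ⟨s₁, hs₁, hs₁max⟩ := Finset.exists_max_image Sv (fun s => A.valuation (s - s₀))
    ⟨α₀, Finset.mem_filter.mpr ⟨Multiset.mem_toFinset.mpr hα₀F, hα₀lt, hα₀s₀⟩⟩
  rw [Finset.mem_filter, Multiset.mem_toFinset] at hs₁
  obtain ⟨hs₁F, hs₁lt, hs₁ne⟩ := hs₁
  have hγ₁0 : A.valuation (s₁ - s₀) ≠ 0 :=
    (Valuation.ne_zero_iff _).mpr (_root_.sub_ne_zero.mpr hs₁ne)
  have hclass : ∀ s ∈ (p * q * (p - q)).roots, A.valuation (s - s₀) < 1 →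
      A.valuation (s - s₀) ≤ A.valuation (s₁ - s₀) := by
    intro s hs hslt
    by_cases hss : s = s₀
    · rw [hss, sub_self, map_zero]; exact zero_le
    · exact hs₁max s (Finset.mem_filter.mpr ⟨Multiset.mem_toFinset.mpr hs, hslt, hss⟩)
  -- a radius strictly between the cluster radius and `1`
  obtain ⟨γ, hγ₁γ, hγ1⟩ := exists_between_of_lt A hγ₁0 hs₁lt
  obtain ⟨e, he⟩ := A.valuation_surjective γ
  rw [← he] at hγ₁γ hγ1
  have he0 : e ≠ 0 := by
    intro h0; rw [h0, map_zero] at hγ₁γ; exact (not_lt.mpr zero_le) hγ₁γ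
  have hinside : ∀ {f : K[X]}, (∀ s ∈ f.roots, s ∈ (p * q * (p - q)).roots) →
      (∀ α ∈ f.roots, A.valuation (α - s₀) ≤ A.valuation e → A.valuation (α - s₀) < A.valuation e) ∧
      rootsIn A f s₀ (A.valuation e) = (redPoly A f).rootMultiplicity x := by
    intro f hf
    have hlt' : ∀ α ∈ f.roots, A.valuation (α - s₀) ≤ A.valuation e →
        A.valuation (α - s₀) ≤ A.valuation (s₁ - s₀) := fun α hα hle =>
      hclass α (hf α hα) (lt_of_le_of_lt hle hγ1)
    refine ⟨fun α hα hle => lt_of_le_of_lt (hlt' α hα hle) hγ₁γ, ?_⟩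
    rw [rootMultiplicity_redPoly, ← hres₀, count_redRoots_eq_rootsInOpen_one A f hs₀A, rootsIn, rootsInOpen]
    congr 1
    refine Multiset.filter_congr fun α hα => ⟨fun hle => lt_of_le_of_lt hle hγ1, fun hlt => ?_⟩
    exact (hclass α (hf α hα) hlt).trans hγ₁γ.le
  have hpF : ∀ s ∈ p.roots, s ∈ (p * q * (p - q)).roots := fun s hs => by
    rw [h.roots_prod]; exact Multiset.mem_add.mpr (Or.inl (Multiset.mem_add.mpr (Or.inl hs)))
  have hqF : ∀ s ∈ q.roots, s ∈ (p * q * (p - q)).roots := fun s hs => by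
    rw [h.roots_prod]; exact Multiset.mem_add.mpr (Or.inl (Multiset.mem_add.mpr (Or.inr hs)))
  have hrF : ∀ s ∈ (p - q).roots, s ∈ (p * q * (p - q)).roots := fun s hs => by
    rw [h.roots_prod]; exact Multiset.mem_add.mpr (Or.inr hs)
  obtain ⟨hp1, hp2⟩ := hinside hpF
  obtain ⟨hq1, hq2⟩ := hinside hqF
  obtain ⟨hr1, hr2⟩ := hinside hrF
  have h' := h.comp s₀ he0
  refine h'.not_fullyNeutral A htame (zero_mem_roots_prod_comp hs₀F he0) A.zero_mem ⟨?_, ?_⟩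
  · rw [redPoly_comp_eq_X_pow A p s₀ he0 hp1, redPoly_comp_eq_X_pow A q s₀ he0 hq1, hp2, hq2, hpq]
  · rw [← sub_comp, redPoly_comp_eq_X_pow A (p - q) s₀ he0 hr1,
      redPoly_comp_eq_X_pow A q s₀ he0 hq1, hr2, hq2, hrq]

/-- **The `0`-region contains no cluster point.**  A tame Belyi pair with two integral special
points of different residues cannot have `gaussVal p < gaussVal q`.  (The reduction `χ₀` of `p/(cq)`
is non-constant; its zeros and poles are exactly the classes with special points; the classes are
unramified elsewhere; the two-point Riemann–Hurwitz count then allows only ONE class with special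
points.) [folklore] -/
theorem IsBelyiPair.not_gaussVal_lt_of_isClusterPair (h : IsBelyiPair d p q)
    (htame : ∀ n : ℕ, 0 < n → n ≤ d → (n : ResidueField A) ≠ 0) (hcl : IsClusterPair A p q)
    (hlt : gaussVal A p < gaussVal A q) : False := by
  haveI : IsAlgClosed (ResidueField A) := Literature.RingTheory.Valuation.isAlgClosed_residueField A
  have hp0 := h.left_ne_zero
  have hq0 := h.right_ne_zero
  obtain ⟨s, hsF, s', hs'F, hsA, hs'A, hss'⟩ := hcl
  set Pt := redPoly A p with hPt
  set Qt := redPoly A q with hQt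
  have hPt0 : Pt ≠ 0 := (monic_redPoly A _).ne_zero
  have hQt0 : Qt ≠ 0 := (monic_redPoly A _).ne_zero
  have hRt : redPoly A (p - q) = Qt := redPoly_sub_eq_of_gaussVal_lt A hlt
  -- not fully neutral: `Pt ≠ Qt`
  have hneq : Pt ≠ Qt := fun heq => h.not_fullyNeutral A htame hsF hsA ⟨heq, hRt⟩
  -- residues of integral special points are roots of `Pt Qt`
  have hSigma : ∀ z ∈ (p * q * (p - q)).roots, ∀ hz : z ∈ A, (Pt * Qt).IsRoot (residue A ⟨z, hz⟩) := by
    intro z hz hzA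
    have key : ∀ {f : K[X]}, z ∈ f.roots → (redPoly A f).IsRoot (residue A ⟨z, hzA⟩) := by
      intro f hf
      have hmem : (⟨z, hzA⟩ : A) ∈ intRoots A f := (mem_intRoots A).mpr hf
      have : residue A ⟨z, hzA⟩ ∈ (redPoly A f).roots := by
        rw [roots_redPoly]; exact Multiset.mem_map_of_mem _ hmem
      exact (mem_roots (monic_redPoly A f).ne_zero).mp this
    rw [IsRoot.def, eval_mul, mul_eq_zero]
    rw [h.roots_prod, Multiset.mem_add, Multiset.mem_add] at hz
    rcases hz with (hz | hz) | hz
    · exact Or.inl (key hz).eq_zero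
    · exact Or.inr (key hz).eq_zero
    · right; have := key hz; rw [hRt] at this; exact this.eq_zero
  -- (a) different degrees
  have hdegne : Pt.natDegree ≠ Qt.natDegree := by
    intro heq
    rw [hPt, hQt, natDegree_redPoly, natDegree_redPoly] at heq
    refine h.card_intRoots_ne A htame hsF hsA heq ?_
    rw [← natDegree_redPoly, ← natDegree_redPoly, hRt]
  -- (b) no class with equal positive orders
  have hordne : ∀ x, 0 < Qt.rootMultiplicity x → Pt.rootMultiplicity x ≠ Qt.rootMultiplicity x := by
    intro x hx heq
    refine h.rootMultiplicity_ne A htame hx heq ?_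
    rw [hRt]
  -- (c) cancel the gcd
  set G := GCDMonoid.gcd Pt Qt with hG
  have hG0 : G ≠ 0 := gcd_ne_zero_of_right hQt0
  set P₁ := Pt / G with hP₁
  set Q₁ := Qt / G with hQ₁
  have hPfac : G * P₁ = Pt := EuclideanDomain.mul_div_cancel' hG0 (gcd_dvd_left _ _)
  have hQfac : G * Q₁ = Qt := EuclideanDomain.mul_div_cancel' hG0 (gcd_dvd_right _ _)
  have hcop : IsCoprime P₁ Q₁ := isCoprime_div_gcd_div_gcd hQt0
  have hP₁0 : P₁ ≠ 0 := fun h0 => hPt0 (by rw [← hPfac, h0, mul_zero])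
  have hQ₁0 : Q₁ ≠ 0 := fun h0 => hQt0 (by rw [← hQfac, h0, mul_zero])
  have hdegP : Pt.natDegree = G.natDegree + P₁.natDegree := by rw [← hPfac, natDegree_mul hG0 hP₁0]
  have hdegQ : Qt.natDegree = G.natDegree + Q₁.natDegree := by rw [← hQfac, natDegree_mul hG0 hQ₁0]
  have hdeg : P₁.natDegree ≠ Q₁.natDegree := fun heq => hdegne (by omega)
  have htame' : ∀ m : ℕ, 0 < m → m ≤ max P₁.natDegree Q₁.natDegree → (m : ResidueField A) ≠ 0 := by
    intro m hm hle
    have hP₁d : P₁.natDegree ≤ d := by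
      have h1 := card_intRoots_le_natDegree A p
      have h2 := h.natDegree_left_le
      have h3 : Pt.natDegree = Multiset.card (intRoots A p) := natDegree_redPoly A p
      omega
    have hQ₁d : Q₁.natDegree ≤ d := by
      have h1 := card_intRoots_le_natDegree A q
      have h2 := h.natDegree_right_le
      have h3 : Qt.natDegree = Multiset.card (intRoots A q) := natDegree_redPoly A q
      omega
    exact htame m hm (hle.trans (max_le hP₁d hQ₁d))
  -- roots of `Pt Qt` are roots of `P₁` or `Q₁`
  have hkey : ∀ x, (Pt * Qt).IsRoot x → P₁.IsRoot x ∨ Q₁.IsRoot x := by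
    intro x hx
    rw [IsRoot.def, eval_mul, mul_eq_zero] at hx
    have hGP : G.rootMultiplicity x ≤ Pt.rootMultiplicity x :=
      rootMultiplicity_le_rootMultiplicity_of_dvd hPt0 (gcd_dvd_left _ _) x
    have hGQ : G.rootMultiplicity x ≤ Qt.rootMultiplicity x :=
      rootMultiplicity_le_rootMultiplicity_of_dvd hQt0 (gcd_dvd_right _ _) x
    have hP₁m := rootMultiplicity_eq_sub_of_mul_eq hPt0 hPfac x
    have hQ₁m := rootMultiplicity_eq_sub_of_mul_eq hQt0 hQfac x
    by_cases hQx : 0 < Qt.rootMultiplicity x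
    · have hne := hordne x hQx
      rcases lt_or_gt_of_ne hne with h1 | h1
      · right
        have : 0 < Q₁.rootMultiplicity x := by rw [hQ₁m]; omega
        exact (rootMultiplicity_pos hQ₁0).mp this
      · left
        have : 0 < P₁.rootMultiplicity x := by rw [hP₁m]; omega
        exact (rootMultiplicity_pos hP₁0).mp this
    · have hQx0 : Qt.rootMultiplicity x = 0 := by omega
      have hPx : Pt.eval x = 0 := by
        rcases hx with hx | hx
        · exact hx
        · exfalso; exact ((rootMultiplicity_pos hQt0).mpr hx).ne' hQx0
      left
      have : 0 < P₁.rootMultiplicity x := by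
        rw [hP₁m]; have := (rootMultiplicity_pos hPt0).mpr hPx; omega
      exact (rootMultiplicity_pos hP₁0).mp this
  -- models of `p` and `q`
  obtain ⟨c₁, hc₁, gP, hgPf, hgPr⟩ := exists_model A hp0 (IsAlgClosed.splits p)
  obtain ⟨c₂, hc₂, gQ, hgQf, hgQr⟩ := exists_model A hq0 (IsAlgClosed.splits q)
  have hshift : ∀ t : A, (gP - C t * gQ).map (algebraMap A K) = C c₁ * (p - C (t * c₂ / c₁) * q) ∧
      (gP - C t * gQ).map (residue A) = Pt - C (residue A t) * Qt := by
    intro t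
    constructor
    · rw [Polynomial.map_sub, Polynomial.map_mul, map_C, hgPf, hgQf, ValuationSubring.algebraMap_apply]
      have hC : C c₁ * C ((t : K) * c₂ / c₁) = C ((t : K) * c₂) := by
        rw [← C_mul, mul_div_cancel₀ _ hc₁]
      calc C c₁ * p - C (t : K) * (C c₂ * q) = C c₁ * p - C ((t : K) * c₂) * q := by rw [C_mul]; ring
        _ = C c₁ * (p - C ((t : K) * c₂ / c₁) * q) := by rw [mul_sub, ← mul_assoc, hC]
    · rw [Polynomial.map_sub, Polynomial.map_mul, map_C, hgPr, hgQr]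
  -- unramified off the zeros and poles
  have hunram : ∀ x : ResidueField A, P₁.eval x ≠ 0 → Q₁.eval x ≠ 0 →
      (P₁ * C (Q₁.eval x) - Q₁ * C (P₁.eval x)).rootMultiplicity x ≤ 1 := by
    intro x hPx hQx
    have hPQx : ¬ (Pt * Qt).IsRoot x := fun hr => by
      rcases hkey x hr with h1 | h1
      · exact hPx h1.eq_zero
      · exact hQx h1.eq_zero
    have hfree : ∀ z ∈ (p * q * (p - q)).roots, ∀ hz : z ∈ A, residue A ⟨z, hz⟩ ≠ x := by
      intro z hz hzA hres
      exact hPQx (hres ▸ hSigma z hz hzA)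
    set w : ResidueField A := P₁.eval x / Q₁.eval x with hw
    obtain ⟨t, ht⟩ := residue_surjective (R := A) w
    obtain ⟨hf, hr⟩ := hshift t
    have hR0 : Pt - C w * Qt ≠ 0 := by
      intro h0
      rw [sub_eq_zero] at h0
      exact hneq (eq_of_monic_of_eq_C_mul (monic_redPoly A _) (monic_redPoly A _) h0)
    have hne : (gP - C t * gQ).map (residue A) ≠ 0 := by rw [hr, ht]; exact hR0
    have hcount := h.count_redRoots_sub_C_mul_le_one A htame hfree (t * c₂ / c₁)
    rw [← roots_map_residue_eq_redRoots (IsAlgClosed.splits _) hf hne, count_roots, hr, ht] at hcount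
    have hRfac : Pt - C w * Qt = G * (P₁ - C w * Q₁) := by rw [← hPfac, ← hQfac]; ring
    have hS0 : P₁ - C w * Q₁ ≠ 0 := fun h0 => hR0 (by rw [hRfac, h0, mul_zero])
    have h1 : (P₁ - C w * Q₁).rootMultiplicity x ≤ (Pt - C w * Qt).rootMultiplicity x := by
      rw [hRfac, rootMultiplicity_mul (by rw [← hRfac]; exact hR0)]
      omega
    have h2 : P₁ * C (Q₁.eval x) - Q₁ * C (P₁.eval x) = C (Q₁.eval x) * (P₁ - C w * Q₁) := by
      rw [hw, mul_sub, ← mul_assoc, ← C_mul, mul_div_cancel₀ _ hQx]; ring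
    rw [h2, rootMultiplicity_mul (mul_ne_zero (by rwa [Ne, C_eq_zero]) hS0), rootMultiplicity_C, zero_add]
    exact h1.trans hcount
  -- two-point Riemann–Hurwitz
  have hcount := card_roots_toFinset_add_eq_one hcop hdeg htame' hunram
  -- (d) but the two residues of the cluster are two distinct zeros/poles
  have hmem : ∀ {z : K} (hz : z ∈ (p * q * (p - q)).roots) (hzA : z ∈ A),
      residue A ⟨z, hzA⟩ ∈ P₁.roots.toFinset ∪ Q₁.roots.toFinset := by
    intro z hz hzA
    rcases hkey _ (hSigma z hz hzA) with h1 | h1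
    · exact Finset.mem_union_left _ (Multiset.mem_toFinset.mpr ((mem_roots hP₁0).mpr h1))
    · exact Finset.mem_union_right _ (Multiset.mem_toFinset.mpr ((mem_roots hQ₁0).mpr h1))
  have htwo : 2 ≤ (P₁.roots.toFinset ∪ Q₁.roots.toFinset).card := by
    have : ({residue A ⟨s, hsA⟩, residue A ⟨s', hs'A⟩} : Finset (ResidueField A)) ⊆
        P₁.roots.toFinset ∪ Q₁.roots.toFinset := by
      intro y hy
      rw [Finset.mem_insert, Finset.mem_singleton] at hy
      rcases hy with rfl | rfl
      · exact hmem hsF hsA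
      · exact hmem hs'F hs'A
    have h2 := Finset.card_le_card this
    rwa [Finset.card_pair hss'] at h2
  have := Finset.card_union_le P₁.roots.toFinset Q₁.roots.toFinset
  omega

/-- **Cluster points are central.**  For a tame Belyi pair with two integral special points of
different residues, the Gauss values of `p`, `q` and `p - q` coincide. [folklore] -/
theorem IsBelyiPair.central_of_isClusterPair (h : IsBelyiPair d p q)
    (htame : ∀ n : ℕ, 0 < n → n ≤ d → (n : ResidueField A) ≠ 0) (hcl : IsClusterPair A p q) :
    gaussVal A p = gaussVal A q ∧ gaussVal A (p - q) = gaussVal A q := by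
  have hpq : gaussVal A p = gaussVal A q := by
    rcases lt_trichotomy (gaussVal A p) (gaussVal A q) with hlt | heq | hgt
    · exact absurd hlt fun hlt => h.not_gaussVal_lt_of_isClusterPair A htame hcl hlt
    · exact heq
    · exact absurd hgt fun hgt => h.swap.not_gaussVal_lt_of_isClusterPair A htame hcl.swap hgt
  refine ⟨hpq, ?_⟩
  rcases lt_or_eq_of_le ((gaussVal_sub_le A p q).trans (by rw [hpq, max_self])) with hlt | heq
  · exfalso
    refine h.oneSub.not_gaussVal_lt_of_isClusterPair A htame hcl.oneSub ?_
    rw [← neg_sub, gaussVal_neg]; exact hlt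
  · exact heq

end Cluster

/-! ### No two comparable central points -/

section Central

variable {K : Type*} [Field K] [IsAlgClosed K] [CharZero K] (A : ValuationSubring K)
variable {d : ℕ} {p q : K[X]}

/-- **No two comparable central points.**  Let `(p, q)` be a tame Belyi pair which is central at
the unit disc (`gaussVal p = gaussVal q = gaussVal (p - q)`), `s₀` an integral special point and
`v c₁ < 1` a radius such that all special points of the residue class of `s₀` lie in
`D(s₀, v c₁)`.  Then the rescaled pair on `D(s₀, v c₁)` is NOT central.  (Between the two radii the
three Gauss values are monomials `g · γ^{α_f}`; equality at both ends forces equal exponents, and a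
radius strictly between would be fully neutral.) [folklore] -/
theorem IsBelyiPair.not_central_below (h : IsBelyiPair d p q)
    (htame : ∀ n : ℕ, 0 < n → n ≤ d → (n : ResidueField A) ≠ 0)
    (hcen : gaussVal A p = gaussVal A q ∧ gaussVal A (p - q) = gaussVal A q)
    {s₀ : K} (hs₀F : s₀ ∈ (p * q * (p - q)).roots) (hs₀A : s₀ ∈ A) {c₁ : K} (hc₁0 : c₁ ≠ 0)
    (hc₁1 : A.valuation c₁ < 1)
    (hclass : ∀ s ∈ (p * q * (p - q)).roots, A.valuation (s - s₀) < 1 → A.valuation (s - s₀) ≤ A.valuation c₁)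
    (hcen₁ : gaussVal A (p.comp (C s₀ + C c₁ * X)) = gaussVal A (q.comp (C s₀ + C c₁ * X)) ∧
      gaussVal A (p.comp (C s₀ + C c₁ * X) - q.comp (C s₀ + C c₁ * X)) =
        gaussVal A (q.comp (C s₀ + C c₁ * X))) : False := by
  have hq0 := h.right_ne_zero
  have hgq : 0 < gaussVal A q := zero_lt_iff.mpr (gaussVal_ne_zero A hq0)
  have hγ₁0 : 0 < A.valuation c₁ := zero_lt_iff.mpr ((Valuation.ne_zero_iff _).mpr hc₁0)
  have hpF : ∀ s ∈ p.roots, s ∈ (p * q * (p - q)).roots := fun s hs => by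
    rw [h.roots_prod]; exact Multiset.mem_add.mpr (Or.inl (Multiset.mem_add.mpr (Or.inl hs)))
  have hqF : ∀ s ∈ q.roots, s ∈ (p * q * (p - q)).roots := fun s hs => by
    rw [h.roots_prod]; exact Multiset.mem_add.mpr (Or.inl (Multiset.mem_add.mpr (Or.inr hs)))
  have hrF : ∀ s ∈ (p - q).roots, s ∈ (p * q * (p - q)).roots := fun s hs => by
    rw [h.roots_prod]; exact Multiset.mem_add.mpr (Or.inr hs)
  -- for each of `p, q, p - q`: the Gauss value on `D(s₀, v e)` is `gaussVal f · (v e)^{α_f}` for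
  -- every radius `v c₁ ≤ v e < 1`, where `α_f` counts the roots in the class
  have key : ∀ {f : K[X]}, f ≠ 0 → (∀ s ∈ f.roots, s ∈ (p * q * (p - q)).roots) →
      ∀ {e : K}, e ≠ 0 → A.valuation c₁ ≤ A.valuation e → A.valuation e < 1 →
        gaussVal A (f.comp (C s₀ + C e * X)) = gaussVal A f * A.valuation e ^ rootsInOpen A f s₀ 1 ∧
        (A.valuation c₁ < A.valuation e →
          redPoly A (f.comp (C s₀ + C e * X)) = X ^ rootsInOpen A f s₀ 1) := by
    intro f hf hfF e he heγ he1
    have hcount : rootsIn A f s₀ (A.valuation e) = rootsInOpen A f s₀ 1 := by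
      rw [rootsIn, rootsInOpen]
      congr 1
      refine Multiset.filter_congr fun α hα => ⟨fun hle => lt_of_le_of_lt hle he1, fun hlt => ?_⟩
      exact (hclass α (hfF α hα) hlt).trans heγ
    have hcoeff : A.valuation ((taylor s₀ f).coeff (rootsInOpen A f s₀ 1)) = gaussVal A f := by
      have := valuation_taylor_coeff_rootsInOpen (A := A) hf (IsAlgClosed.splits f) s₀ one_ne_zero
      rwa [map_one, one_pow, mul_one, gaussValAt_one_eq_gaussVal A f hs₀A] at this
    refine ⟨?_, fun hlt => ?_⟩
    · rw [gaussVal_comp, ← valuation_taylor_coeff_rootsIn hf (IsAlgClosed.splits f) s₀ he, hcount, hcoeff]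
    · rw [redPoly_comp_eq_X_pow A f s₀ he, hcount]
      intro α hα hle
      by_cases h1 : A.valuation (α - s₀) < 1
      · exact lt_of_le_of_lt (hclass α (hfF α hα) h1) hlt
      · exact absurd (lt_of_le_of_lt hle he1) h1
  -- exponents coincide
  obtain ⟨hp₁, -⟩ := key h.left_ne_zero hpF hc₁0 le_rfl hc₁1
  obtain ⟨hq₁, -⟩ := key hq0 hqF hc₁0 le_rfl hc₁1
  obtain ⟨hr₁, -⟩ := key h.sub_ne_zero hrF hc₁0 le_rfl hc₁1
  have hanti : StrictAnti fun n : ℕ => A.valuation c₁ ^ n := pow_right_strictAnti₀ hγ₁0 hc₁1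
  have hαpq : rootsInOpen A p s₀ 1 = rootsInOpen A q s₀ 1 := by
    apply hanti.injective
    have := hcen₁.1
    rw [hp₁, hq₁, hcen.1] at this
    exact mul_left_cancel₀ hgq.ne' this
  have hαrq : rootsInOpen A (p - q) s₀ 1 = rootsInOpen A q s₀ 1 := by
    apply hanti.injective
    have := hcen₁.2
    rw [← sub_comp, hr₁, hq₁, hcen.2] at this
    exact mul_left_cancel₀ hgq.ne' this
  -- a radius strictly between is fully neutral
  obtain ⟨γ, hγ₁γ, hγ1⟩ := exists_between_of_lt A hγ₁0.ne' hc₁1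
  obtain ⟨e, he⟩ := A.valuation_surjective γ
  rw [← he] at hγ₁γ hγ1
  have he0 : e ≠ 0 := by
    intro h0; rw [h0, map_zero] at hγ₁γ; exact (not_lt.mpr zero_le) hγ₁γ
  obtain ⟨-, hpe⟩ := key h.left_ne_zero hpF he0 hγ₁γ.le hγ1
  obtain ⟨-, hqe⟩ := key hq0 hqF he0 hγ₁γ.le hγ1
  obtain ⟨-, hre⟩ := key h.sub_ne_zero hrF he0 hγ₁γ.le hγ1
  refine (h.comp s₀ he0).not_fullyNeutral A htame (zero_mem_roots_prod_comp hs₀F he0) A.zero_mem ⟨?_, ?_⟩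
  · rw [hpe hγ₁γ, hqe hγ₁γ, hαpq]
  · rw [← sub_comp, hre hγ₁γ, hqe hγ₁γ, hαrq]

omit [CharZero K] in
/-- Central-ness is invariant under integral translations. [folklore] -/
theorem gaussVal_comp_X_add_C (f : K[X]) {s₀ : K} (hs₀ : s₀ ∈ A) :
    gaussVal A (f.comp (C s₀ + C 1 * X)) = gaussVal A f := by
  rw [gaussVal_comp, map_one, gaussValAt_one_eq_gaussVal A f hs₀]

end Central

end Literature.NumberTheory.DiophantineGeometry

end
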